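import Summits.HubbardSuperconductivity.HubbardSuperconductivity.Theorems.AnisotropyChordTransferFibre3KernelDiffSum

/-!
# Route `AnisotropyChord` / H0 rotor rung: SECOND-DIFFERENCE LEMMAS for the torus kernel symbol — towards the sharp periodisation rate `O(|r|² ln L/L²)`

Eighth file of the periodisation toolkit (memo ROTOR-THEORY-21 §320–§322).  The first-difference route
(`…KernelDiffSum`, `…DyadicRate`) gives `|a^{(L)}_0(r) − a_∞(r)| ≤ 2C₀|r|²/L`; summing the alternating coset sums by parts TWICE
improves this to `O(|r|² ln L/L²)` (true law `|r|²/(4V)`).  This file holds the pointwise ingredients for `h_r(n) = u(n)/v(n)`,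
`u = 1 − Re φ_n(r)`, `v = 2ε(n)`, along `n, n + eₓ, n + 2eₓ`:
* `abs_cos_second_diff_le` (`|cos(a−b) − 2cos a + cos(a+b)| ≤ 2(1 − cos b)`), `rep_succ_succ_congr`;
* first differences restated as lemmas: `abs_du_le` (`|Δu| ≤ θ²ρ(l1 + ½)`), `abs_dv_le` (`|Δv| ≤ θ²(2·l1 + 1)`);
* ★ second differences: `abs_d2u_le` (`|Δ²u| ≤ θ²ρ`), `abs_d2v_le` (`|Δ²v| ≤ 2θ²`);
* ★ the abstract estimates: `recip_diff_bounds` (bounds for `1/v` and its first/second differences from `v ≥ cTa²`, `|Δv| ≤ T(2a+1)`,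
  `|Δ²v| ≤ 2T`) and `quotient_diff2_bound` (`|Δ²(u·w)| ≤ (1/c + 53/(2c²) + 48/c³)·ρ/a₁²`).
Prover seat `hubbard-h0-rotor-p2` g2; helper for stmt-19089. WHAT THIS IS NOT: nothing here proves superconductivity in the Hubbard
model (rotor TARGET stays FALSE, g15); elementary estimates for ONE input (periodisation) of HOLE₂ of rung 19089. No sorry, no axioms.
-/

set_option linter.dupNamespace false

noncomputable section

open scoped BigOperators
open Complex Finset

namespace Summit.HubbardSuperconductivity.HubbardSuperconductivity.Theorems.AnisotropyChord.Transfer.Fibre3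

namespace Subsample

variable (N : ℕ) [NeZero N]

/-- `|cos(a − b) − 2cos a + cos(a + b)| ≤ 2(1 − cos b)`. [folklore] -/
theorem abs_cos_second_diff_le (a b : ℝ) :
    |Real.cos (a - b) - 2 * Real.cos a + Real.cos (a + b)| ≤ 2 * (1 - Real.cos b) := by
  have h : Real.cos (a - b) - 2 * Real.cos a + Real.cos (a + b) = -(2 * Real.cos a * (1 - Real.cos b)) := by
    rw [Real.cos_sub, Real.cos_add]; ring
  rw [h, abs_neg, abs_mul, abs_mul, abs_two, abs_of_nonneg (by linarith [Real.cos_le_one b] : (0 : ℝ) ≤ 1 - Real.cos b)]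
  have h1 := Real.abs_cos_le_one a
  have h2 : (0 : ℝ) ≤ 1 - Real.cos b := by linarith [Real.cos_le_one b]
  nlinarith

/-- `2(1 − cos b) ≤ b²`. [folklore] -/
theorem two_mul_one_sub_cos_le_sq (b : ℝ) : 2 * (1 - Real.cos b) ≤ b ^ 2 := by
  have := Real.one_sub_sq_div_two_le_cos (x := b)
  linarith

omit [NeZero N] in
/-- the representative of `n + 2eₓ`: `valMinAbs((n + eₓ + eₓ)₁) ≡ valMinAbs(n₁) + 2 (mod N)`. [folklore] -/
theorem rep_succ_succ_congr (n : Tor N) :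
    ((((n + ex N + ex N).1.valMinAbs : ℤ)) : ZMod N) = (((n.1.valMinAbs + 2 : ℤ)) : ZMod N) := by
  have h1 := rep_succ_congr N (n + ex N)
  have h2 := rep_succ_congr N n
  push_cast at h1 h2 ⊢
  rw [h1, h2]
  ring

/-- `|Δu| ≤ θ²ρ(l1(n) + ½)` for `u(n) = 1 − Re φ_n(r)`, `r = (x, y)`, `ρ = x² + y²`. [folklore] -/
theorem abs_du_le (x y : ℤ) (n : Tor N) :
    |(1 - (phase N (n + ex N) (((x : ℤ) : ZMod N), ((y : ℤ) : ZMod N))).re)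
        - (1 - (phase N n (((x : ℤ) : ZMod N), ((y : ℤ) : ZMod N))).re)|
      ≤ (2 * Real.pi / N) ^ 2 * ((x : ℝ) ^ 2 + (y : ℝ) ^ 2) * (l1 N n + 1 / 2) := by
  set θ : ℝ := 2 * Real.pi / N with hθ
  have hN : (0 : ℝ) < N := by exact_mod_cast Nat.pos_of_ne_zero (NeZero.ne N)
  have hθpos : 0 < θ := by rw [hθ]; positivity
  have hA' : ((((n + ex N).1.valMinAbs * x + (n + ex N).2.valMinAbs * y : ℤ)) : ZMod N)
      = (((n.1.valMinAbs * x + n.2.valMinAbs * y + x : ℤ)) : ZMod N) := by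
    have h1 := rep_succ_congr N n
    have h2 : (n + ex N).2 = n.2 := by simp [ex]
    push_cast at h1 ⊢
    rw [h2, h1]
    ring
  rw [re_phase_rep, re_phase_rep, cos_theta_congr N hA', ← hθ]
  rw [show (1 - Real.cos (θ * ((n.1.valMinAbs * x + n.2.valMinAbs * y + x : ℤ) : ℝ)))
      - (1 - Real.cos (θ * ((n.1.valMinAbs * x + n.2.valMinAbs * y : ℤ) : ℝ)))
      = Real.cos (θ * ((n.1.valMinAbs * x + n.2.valMinAbs * y : ℤ) : ℝ))
        - Real.cos (θ * ((n.1.valMinAbs * x + n.2.valMinAbs * y + x : ℤ) : ℝ)) by ring]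
  refine (abs_cos_sub_cos_le_mul _ _).trans ?_
  set A : ℝ := ((n.1.valMinAbs * x + n.2.valMinAbs * y : ℤ) : ℝ) with hA
  have e1 : θ * A + θ * ((n.1.valMinAbs * x + n.2.valMinAbs * y + x : ℤ) : ℝ) = θ * (2 * A + x) := by
    rw [hA]; push_cast; ring
  have e2 : θ * A - θ * ((n.1.valMinAbs * x + n.2.valMinAbs * y + x : ℤ) : ℝ) = -(θ * x) := by
    rw [hA]; push_cast; ring
  rw [e1, e2, abs_neg, abs_mul, abs_mul, abs_of_pos hθpos]
  have hdot := dot_mul_le N n x y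
  rw [← hA] at hdot
  have h2A : |2 * A + (x : ℝ)| ≤ 2 * |A| + |(x : ℝ)| := by
    calc |2 * A + (x : ℝ)| ≤ |2 * A| + |(x : ℝ)| := abs_add_le _ _
      _ = 2 * |A| + |(x : ℝ)| := by rw [abs_mul, abs_two]
  have hx2 : |(x : ℝ)| * |(x : ℝ)| = (x : ℝ) ^ 2 := by rw [← sq, sq_abs]
  calc θ * |2 * A + (x : ℝ)| * (θ * |(x : ℝ)|) / 2 = θ ^ 2 * (|2 * A + (x : ℝ)| * |(x : ℝ)| / 2) := by ring
    _ ≤ θ ^ 2 * ((2 * |A| + |(x : ℝ)|) * |(x : ℝ)| / 2) := by gcongr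
    _ = θ ^ 2 * (|A| * |(x : ℝ)| + (x : ℝ) ^ 2 / 2) := by rw [← hx2]; ring
    _ ≤ θ ^ 2 * ((l1 N n + 1 / 2) * ((x : ℝ) ^ 2 + (y : ℝ) ^ 2)) := by gcongr
    _ = _ := by ring

/-- `|Δv| ≤ θ²(2·l1(n) + 1)` for `v(n) = 2ε(n)`. [folklore] -/
theorem abs_dv_le (n : Tor N) :
    |2 * epsT N n - 2 * epsT N (n + ex N)| ≤ (2 * Real.pi / N) ^ 2 * (2 * l1 N n + 1) := by
  set θ : ℝ := 2 * Real.pi / N with hθ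
  have hN : (0 : ℝ) < N := by exact_mod_cast Nat.pos_of_ne_zero (NeZero.ne N)
  have hθpos : 0 < θ := by rw [hθ]; positivity
  rw [epsT_eq_wInt, epsT_eq_wInt]
  have h2 : (n + ex N).2 = n.2 := by simp [ex]
  rw [h2]
  unfold wInt
  have hc : Real.cos (2 * Real.pi * (((n + ex N).1.valMinAbs : ℤ) : ℝ) / N)
      = Real.cos (θ * ((n.1.valMinAbs + 1 : ℤ) : ℝ)) := by
    rw [show 2 * Real.pi * (((n + ex N).1.valMinAbs : ℤ) : ℝ) / N = 2 * Real.pi / N * (((n + ex N).1.valMinAbs : ℤ) : ℝ)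
      by ring, cos_theta_congr N (rep_succ_congr N n), hθ]
  rw [hc, show 2 * Real.pi * ((n.1.valMinAbs : ℤ) : ℝ) / N = θ * ((n.1.valMinAbs : ℤ) : ℝ) by rw [hθ]; ring]
  set m : ℝ := ((n.1.valMinAbs : ℤ) : ℝ) with hm
  rw [show (2 * (1 - Real.cos (θ * m) + (1 - Real.cos (2 * Real.pi * ((n.2.valMinAbs : ℤ) : ℝ) / N)))
      - 2 * (1 - Real.cos (θ * ((n.1.valMinAbs + 1 : ℤ) : ℝ))
        + (1 - Real.cos (2 * Real.pi * ((n.2.valMinAbs : ℤ) : ℝ) / N))))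
      = 2 * (Real.cos (θ * ((n.1.valMinAbs + 1 : ℤ) : ℝ)) - Real.cos (θ * m)) by ring]
  rw [abs_mul, abs_two]
  refine (mul_le_mul_of_nonneg_left (abs_cos_sub_cos_le_mul _ _) (by norm_num)).trans ?_
  have e1 : θ * ((n.1.valMinAbs + 1 : ℤ) : ℝ) + θ * m = θ * (2 * m + 1) := by rw [hm]; push_cast; ring
  have e2 : θ * ((n.1.valMinAbs + 1 : ℤ) : ℝ) - θ * m = θ := by rw [hm]; push_cast; ring
  rw [e1, e2, abs_mul, abs_of_pos hθpos]
  have hml : |m| ≤ l1 N n := by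
    unfold l1; rw [hm]
    have := abs_nonneg ((n.2.valMinAbs : ℤ) : ℝ)
    linarith
  have : |2 * m + 1| ≤ 2 * l1 N n + 1 := by
    calc |2 * m + 1| ≤ |2 * m| + |1| := abs_add_le _ _
      _ = 2 * |m| + 1 := by rw [abs_mul, abs_two, abs_one]
      _ ≤ 2 * l1 N n + 1 := by linarith
  calc 2 * (θ * |2 * m + 1| * θ / 2) = θ ^ 2 * |2 * m + 1| := by ring
    _ ≤ θ ^ 2 * (2 * l1 N n + 1) := by gcongr

/-- ★ `|Δ²u| ≤ θ²x² ≤ θ²ρ`: `|u(n + 2eₓ) − 2u(n + eₓ) + u(n)| ≤ θ²·(x² + y²)`. [folklore] -/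
theorem abs_d2u_le (x y : ℤ) (n : Tor N) :
    |(1 - (phase N (n + ex N + ex N) (((x : ℤ) : ZMod N), ((y : ℤ) : ZMod N))).re)
        - 2 * (1 - (phase N (n + ex N) (((x : ℤ) : ZMod N), ((y : ℤ) : ZMod N))).re)
        + (1 - (phase N n (((x : ℤ) : ZMod N), ((y : ℤ) : ZMod N))).re)|
      ≤ (2 * Real.pi / N) ^ 2 * ((x : ℝ) ^ 2 + (y : ℝ) ^ 2) := by
  set θ : ℝ := 2 * Real.pi / N with hθ
  have hA1 : ((((n + ex N).1.valMinAbs * x + (n + ex N).2.valMinAbs * y : ℤ)) : ZMod N)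
      = (((n.1.valMinAbs * x + n.2.valMinAbs * y + x : ℤ)) : ZMod N) := by
    have h1 := rep_succ_congr N n
    have h2 : (n + ex N).2 = n.2 := by simp [ex]
    push_cast at h1 ⊢
    rw [h2, h1]
    ring
  have hA2 : ((((n + ex N + ex N).1.valMinAbs * x + (n + ex N + ex N).2.valMinAbs * y : ℤ)) : ZMod N)
      = (((n.1.valMinAbs * x + n.2.valMinAbs * y + 2 * x : ℤ)) : ZMod N) := by
    have h1 := rep_succ_succ_congr N n
    have h2 : (n + ex N + ex N).2 = n.2 := by simp [ex]
    push_cast at h1 ⊢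
    rw [h2, h1]
    ring
  rw [re_phase_rep, re_phase_rep, re_phase_rep, cos_theta_congr N hA1, cos_theta_congr N hA2, ← hθ]
  set A : ℝ := ((n.1.valMinAbs * x + n.2.valMinAbs * y : ℤ) : ℝ) with hA
  have e0 : θ * ((n.1.valMinAbs * x + n.2.valMinAbs * y + x : ℤ) : ℝ) = θ * (A + x) := by rw [hA]; push_cast; ring
  have e2 : θ * ((n.1.valMinAbs * x + n.2.valMinAbs * y + 2 * x : ℤ) : ℝ) = θ * (A + x) + θ * x := by
    rw [hA]; push_cast; ring
  have eA : θ * A = θ * (A + x) - θ * x := by ring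
  rw [e0, e2, eA]
  rw [show (1 - Real.cos (θ * (A + ↑x) + θ * ↑x)) - 2 * (1 - Real.cos (θ * (A + ↑x))) + (1 - Real.cos (θ * (A + ↑x) - θ * ↑x))
      = -(Real.cos (θ * (A + ↑x) - θ * ↑x) - 2 * Real.cos (θ * (A + ↑x)) + Real.cos (θ * (A + ↑x) + θ * ↑x)) by ring,
    abs_neg]
  refine (abs_cos_second_diff_le _ _).trans ((two_mul_one_sub_cos_le_sq _).trans ?_)
  rw [mul_pow]
  have : (x : ℝ) ^ 2 ≤ (x : ℝ) ^ 2 + (y : ℝ) ^ 2 := by nlinarith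
  exact mul_le_mul_of_nonneg_left this (by positivity)

/-- ★ `|Δ²v| ≤ 2θ²`: `|2ε(n + 2eₓ) − 2·2ε(n + eₓ) + 2ε(n)| ≤ 2θ²`. [folklore] -/
theorem abs_d2v_le (n : Tor N) :
    |2 * epsT N (n + ex N + ex N) - 2 * (2 * epsT N (n + ex N)) + 2 * epsT N n| ≤ 2 * (2 * Real.pi / N) ^ 2 := by
  set θ : ℝ := 2 * Real.pi / N with hθ
  rw [epsT_eq_wInt, epsT_eq_wInt, epsT_eq_wInt]
  have h2 : (n + ex N).2 = n.2 := by simp [ex]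
  have h2' : (n + ex N + ex N).2 = n.2 := by simp [ex]
  rw [h2, h2']
  unfold wInt
  have hc1 : Real.cos (2 * Real.pi * (((n + ex N).1.valMinAbs : ℤ) : ℝ) / N)
      = Real.cos (θ * ((n.1.valMinAbs + 1 : ℤ) : ℝ)) := by
    rw [show 2 * Real.pi * (((n + ex N).1.valMinAbs : ℤ) : ℝ) / N = 2 * Real.pi / N * (((n + ex N).1.valMinAbs : ℤ) : ℝ)
      by ring, cos_theta_congr N (rep_succ_congr N n), hθ]
  have hc2 : Real.cos (2 * Real.pi * (((n + ex N + ex N).1.valMinAbs : ℤ) : ℝ) / N)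
      = Real.cos (θ * ((n.1.valMinAbs + 2 : ℤ) : ℝ)) := by
    rw [show 2 * Real.pi * (((n + ex N + ex N).1.valMinAbs : ℤ) : ℝ) / N
        = 2 * Real.pi / N * (((n + ex N + ex N).1.valMinAbs : ℤ) : ℝ) by ring, cos_theta_congr N (rep_succ_succ_congr N n), hθ]
  rw [hc1, hc2, show 2 * Real.pi * ((n.1.valMinAbs : ℤ) : ℝ) / N = θ * ((n.1.valMinAbs : ℤ) : ℝ) by rw [hθ]; ring]
  set m : ℝ := ((n.1.valMinAbs : ℤ) : ℝ) with hm
  have e1 : θ * ((n.1.valMinAbs + 1 : ℤ) : ℝ) = θ * (m + 1) := by rw [hm]; push_cast; ring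
  have e2 : θ * ((n.1.valMinAbs + 2 : ℤ) : ℝ) = θ * (m + 1) + θ := by rw [hm]; push_cast; ring
  have e0 : θ * m = θ * (m + 1) - θ := by ring
  rw [e1, e2, e0]
  set c2 := Real.cos (2 * Real.pi * ((n.2.valMinAbs : ℤ) : ℝ) / N)
  rw [show 2 * (1 - Real.cos (θ * (m + 1) + θ) + (1 - c2)) - 2 * (2 * (1 - Real.cos (θ * (m + 1)) + (1 - c2)))
      + 2 * (1 - Real.cos (θ * (m + 1) - θ) + (1 - c2))
      = -(2 * (Real.cos (θ * (m + 1) - θ) - 2 * Real.cos (θ * (m + 1)) + Real.cos (θ * (m + 1) + θ))) by ring,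
    abs_neg, abs_mul, abs_two]
  have h := (abs_cos_second_diff_le (θ * (m + 1)) θ).trans (two_mul_one_sub_cos_le_sq θ)
  linarith

/-- ★ bounds for the reciprocal `w = 1/v` along three points: from `v_i ≥ cTa_i²`, `|Δv| ≤ T(2a + 1)`, `|Δ²v| ≤ 2T`. [folklore] -/
theorem recip_diff_bounds {v0 v1 v2 T c a0 a1 a2 : ℝ} (hT : 0 < T) (hc : 0 < c)
    (ha0 : 1 ≤ a0) (ha1 : 1 ≤ a1) (ha2 : 1 ≤ a2)
    (hv0 : c * T * a0 ^ 2 ≤ v0) (hv1 : c * T * a1 ^ 2 ≤ v1) (hv2 : c * T * a2 ^ 2 ≤ v2)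
    (hdv0 : |v1 - v0| ≤ T * (2 * a0 + 1)) (hdv1 : |v2 - v1| ≤ T * (2 * a1 + 1)) (hd2v : |v2 - 2 * v1 + v0| ≤ 2 * T) :
    1 / v1 ≤ 1 / (c * T * a1 ^ 2) ∧
    |1 / v1 - 1 / v0| ≤ (2 * a0 + 1) / (c ^ 2 * T * a0 ^ 2 * a1 ^ 2) ∧
    |1 / v2 - 1 / v1| ≤ (2 * a1 + 1) / (c ^ 2 * T * a1 ^ 2 * a2 ^ 2) ∧
    |1 / v2 - 2 * (1 / v1) + 1 / v0|
      ≤ 2 / (c ^ 2 * T * a1 ^ 2 * a2 ^ 2) + (2 * a0 + 1) * (2 * a0 + 2 * a1 + 2) / (c ^ 3 * T * a0 ^ 2 * a1 ^ 2 * a2 ^ 2) := by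
  have hb0 : 0 < c * T * a0 ^ 2 := by positivity
  have hb1 : 0 < c * T * a1 ^ 2 := by positivity
  have hb2 : 0 < c * T * a2 ^ 2 := by positivity
  have hp0 : 0 < v0 := lt_of_lt_of_le hb0 hv0
  have hp1 : 0 < v1 := lt_of_lt_of_le hb1 hv1
  have hp2 : 0 < v2 := lt_of_lt_of_le hb2 hv2
  refine ⟨one_div_le_one_div_of_le hb1 hv1, ?_, ?_, ?_⟩
  · rw [div_sub_div _ _ hp1.ne' hp0.ne', one_mul, mul_one, abs_div, abs_of_pos (mul_pos hp1 hp0), abs_sub_comm]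
    calc |v1 - v0| / (v1 * v0) ≤ T * (2 * a0 + 1) / (c * T * a1 ^ 2 * (c * T * a0 ^ 2)) :=
          div_le_div₀ (by positivity) hdv0 (by positivity) (mul_le_mul hv1 hv0 hb0.le hp1.le)
      _ = _ := by rw [div_eq_div_iff (by positivity) (by positivity)]; ring
  · rw [div_sub_div _ _ hp2.ne' hp1.ne', one_mul, mul_one, abs_div, abs_of_pos (mul_pos hp2 hp1), abs_sub_comm]
    calc |v2 - v1| / (v2 * v1) ≤ T * (2 * a1 + 1) / (c * T * a2 ^ 2 * (c * T * a1 ^ 2)) :=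
          div_le_div₀ (by positivity) hdv1 (by positivity) (mul_le_mul hv2 hv1 hb1.le hp2.le)
      _ = _ := by rw [div_eq_div_iff (by positivity) (by positivity)]; ring
  · have key : 1 / v2 - 2 * (1 / v1) + 1 / v0
        = (-(v2 - 2 * v1 + v0) * v0 + (v1 - v0) * ((v1 - v0) + (v2 - v1))) / (v0 * v1 * v2) := by
      field_simp
      ring
    rw [key, abs_div, abs_of_pos (by positivity : 0 < v0 * v1 * v2)]
    have hnum : |-(v2 - 2 * v1 + v0) * v0 + (v1 - v0) * ((v1 - v0) + (v2 - v1))|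
        ≤ 2 * T * v0 + T * (2 * a0 + 1) * (T * (2 * a0 + 1) + T * (2 * a1 + 1)) := by
      refine (abs_add_le _ _).trans (add_le_add ?_ ?_)
      · rw [abs_mul, abs_neg, abs_of_pos hp0]
        exact mul_le_mul_of_nonneg_right hd2v hp0.le
      · rw [abs_mul]
        refine mul_le_mul hdv0 ((abs_add_le _ _).trans (add_le_add hdv0 hdv1)) (abs_nonneg _) (by positivity)
    refine (div_le_div_of_nonneg_right hnum (by positivity)).trans ?_
    rw [add_div]
    refine add_le_add ?_ ?_
    · rw [show 2 * T * v0 / (v0 * v1 * v2) = 2 * T / (v1 * v2) by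
        rw [div_eq_div_iff (by positivity) (by positivity)]; ring]
      calc 2 * T / (v1 * v2) ≤ 2 * T / (c * T * a1 ^ 2 * (c * T * a2 ^ 2)) :=
            div_le_div_of_nonneg_left (by positivity) (by positivity) (mul_le_mul hv1 hv2 hb2.le hp1.le)
        _ = _ := by rw [div_eq_div_iff (by positivity) (by positivity)]; ring
    · calc T * (2 * a0 + 1) * (T * (2 * a0 + 1) + T * (2 * a1 + 1)) / (v0 * v1 * v2)
          ≤ T * (2 * a0 + 1) * (T * (2 * a0 + 1) + T * (2 * a1 + 1)) / (c * T * a0 ^ 2 * (c * T * a1 ^ 2) * (c * T * a2 ^ 2)) :=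
            div_le_div_of_nonneg_left (by positivity) (by positivity)
              (mul_le_mul (mul_le_mul hv0 hv1 hb1.le hp0.le) hv2 hb2.le (by positivity))
        _ = _ := by rw [div_eq_div_iff (by positivity) (by positivity)]; ring

/-- polynomial bookkeeping: `(2a₀+1)(2a₀+2a₁+2) ≤ 24a₀²` for `a₀ ≥ 1`, `a₁ ≤ a₀ + 1`. [folklore] -/
theorem poly_aux1 {a0 a1 : ℝ} (ha0 : 1 ≤ a0) (h10 : a1 ≤ a0 + 1) :
    (2 * a0 + 1) * (2 * a0 + 2 * a1 + 2) ≤ 24 * a0 ^ 2 := by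
  have h1 : 2 * a0 + 2 * a1 + 2 ≤ 4 * a0 + 4 := by linarith
  have h2 : (2 * a0 + 1) * (2 * a0 + 2 * a1 + 2) ≤ (2 * a0 + 1) * (4 * a0 + 4) :=
    mul_le_mul_of_nonneg_left h1 (by linarith)
  have h3 : a0 ≤ a0 ^ 2 := by nlinarith
  nlinarith

/-- polynomial bookkeeping: `(a+½)(2a+1) ≤ (9/2)a²` for `a ≥ 1`. [folklore] -/
theorem poly_aux2 {a : ℝ} (ha : 1 ≤ a) : (a + 1 / 2) * (2 * a + 1) ≤ 9 / 2 * a ^ 2 := by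
  have h3 : a ≤ a ^ 2 := by nlinarith
  nlinarith

/-- `1/a₂² ≤ 4/a₁²` when `1 ≤ a₂`, `a₁ ≤ a₂ + 1`. [folklore] -/
theorem inv_sq_le_four_div {a1 a2 : ℝ} (ha1 : 1 ≤ a1) (ha2 : 1 ≤ a2) (h12 : a1 ≤ a2 + 1) :
    1 / a2 ^ 2 ≤ 4 / a1 ^ 2 := by
  have h2 : a1 ≤ 2 * a2 := by linarith
  have hsq : a1 ^ 2 ≤ (2 * a2) ^ 2 := pow_le_pow_left₀ (by linarith) h2 2
  rw [div_le_div_iff₀ (by positivity) (by positivity)]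
  nlinarith

/-- term 1 of the second-difference estimate: `|Δ²u|·w₁ ≤ (1/c)·ρ/a₁²`. [folklore] -/
theorem d2_term1 {d2u w1 T c a1 ρ : ℝ} (hT : 0 < T) (hc : 0 < c) (ha1 : 1 ≤ a1) (hρ : 0 ≤ ρ)
    (hd2u : |d2u| ≤ T * ρ) (hw1 : 0 ≤ w1) (hw1' : w1 ≤ 1 / (c * T * a1 ^ 2)) :
    |d2u * w1| ≤ (1 / c) * (ρ / a1 ^ 2) := by
  have ha1p : 0 < a1 := by linarith
  rw [abs_mul, abs_of_nonneg hw1]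
  calc |d2u| * w1 ≤ (T * ρ) * (1 / (c * T * a1 ^ 2)) := mul_le_mul hd2u hw1' hw1 (by positivity)
    _ = (1 / c) * (ρ / a1 ^ 2) := by field_simp

/-- term 2: `u₁·|Δ²w| ≤ (4/c² + 48/c³)·ρ/a₁²`. [folklore] -/
theorem d2_term2 {u1 d2w T c a0 a1 a2 ρ : ℝ} (hT : 0 < T) (hc : 0 < c) (ha0 : 1 ≤ a0) (ha1 : 1 ≤ a1) (ha2 : 1 ≤ a2)
    (hρ : 0 ≤ ρ) (h10 : a1 ≤ a0 + 1) (h12 : a1 ≤ a2 + 1) (hu1 : 0 ≤ u1) (hu1' : u1 ≤ T * a1 ^ 2 * ρ / 2)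
    (hd2w : |d2w| ≤ 2 / (c ^ 2 * T * a1 ^ 2 * a2 ^ 2)
      + (2 * a0 + 1) * (2 * a0 + 2 * a1 + 2) / (c ^ 3 * T * a0 ^ 2 * a1 ^ 2 * a2 ^ 2)) :
    |u1 * d2w| ≤ (4 / c ^ 2 + 48 / c ^ 3) * (ρ / a1 ^ 2) := by
  have ha0p : 0 < a0 := by linarith
  have ha1p : 0 < a1 := by linarith
  have ha2p : 0 < a2 := by linarith
  have hc2 := inv_sq_le_four_div ha1 ha2 h12
  rw [abs_mul, abs_of_nonneg hu1]
  refine (mul_le_mul hu1' hd2w (abs_nonneg _) (by positivity)).trans ?_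
  have hA : T * a1 ^ 2 * ρ / 2 * (2 / (c ^ 2 * T * a1 ^ 2 * a2 ^ 2)) ≤ 4 / c ^ 2 * (ρ / a1 ^ 2) := by
    have e : T * a1 ^ 2 * ρ / 2 * (2 / (c ^ 2 * T * a1 ^ 2 * a2 ^ 2)) = (ρ / c ^ 2) * (1 / a2 ^ 2) := by
      field_simp
    rw [e]
    calc (ρ / c ^ 2) * (1 / a2 ^ 2) ≤ (ρ / c ^ 2) * (4 / a1 ^ 2) := mul_le_mul_of_nonneg_left hc2 (by positivity)
      _ = _ := by ring
  have hB : T * a1 ^ 2 * ρ / 2 * ((2 * a0 + 1) * (2 * a0 + 2 * a1 + 2) / (c ^ 3 * T * a0 ^ 2 * a1 ^ 2 * a2 ^ 2))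
      ≤ 48 / c ^ 3 * (ρ / a1 ^ 2) := by
    have h24 : (2 * a0 + 1) * (2 * a0 + 2 * a1 + 2) / a0 ^ 2 ≤ 24 := by
      rw [div_le_iff₀ (by positivity)]
      exact poly_aux1 ha0 h10
    have e : T * a1 ^ 2 * ρ / 2 * ((2 * a0 + 1) * (2 * a0 + 2 * a1 + 2) / (c ^ 3 * T * a0 ^ 2 * a1 ^ 2 * a2 ^ 2))
        = (ρ / (2 * c ^ 3)) * (((2 * a0 + 1) * (2 * a0 + 2 * a1 + 2) / a0 ^ 2) * (1 / a2 ^ 2)) := by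
      field_simp
    rw [e]
    have hprod : ((2 * a0 + 1) * (2 * a0 + 2 * a1 + 2) / a0 ^ 2) * (1 / a2 ^ 2) ≤ 24 * (4 / a1 ^ 2) :=
      mul_le_mul h24 hc2 (by positivity) (by norm_num)
    calc (ρ / (2 * c ^ 3)) * (((2 * a0 + 1) * (2 * a0 + 2 * a1 + 2) / a0 ^ 2) * (1 / a2 ^ 2))
        ≤ (ρ / (2 * c ^ 3)) * (24 * (4 / a1 ^ 2)) := mul_le_mul_of_nonneg_left hprod (by positivity)
      _ = _ := by ring
  calc T * a1 ^ 2 * ρ / 2 * (2 / (c ^ 2 * T * a1 ^ 2 * a2 ^ 2)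
        + (2 * a0 + 1) * (2 * a0 + 2 * a1 + 2) / (c ^ 3 * T * a0 ^ 2 * a1 ^ 2 * a2 ^ 2))
      = T * a1 ^ 2 * ρ / 2 * (2 / (c ^ 2 * T * a1 ^ 2 * a2 ^ 2))
        + T * a1 ^ 2 * ρ / 2 * ((2 * a0 + 1) * (2 * a0 + 2 * a1 + 2) / (c ^ 3 * T * a0 ^ 2 * a1 ^ 2 * a2 ^ 2)) :=
        mul_add _ _ _
    _ ≤ 4 / c ^ 2 * (ρ / a1 ^ 2) + 48 / c ^ 3 * (ρ / a1 ^ 2) := add_le_add hA hB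
    _ = _ := by ring

/-- term 3: `|Δu₁|·|Δw₁| ≤ (18/c²)·ρ/a₁²`. [folklore] -/
theorem d2_term3 {du1 dw1 T c a1 a2 ρ : ℝ} (hT : 0 < T) (hc : 0 < c) (ha1 : 1 ≤ a1) (ha2 : 1 ≤ a2) (hρ : 0 ≤ ρ)
    (h12 : a1 ≤ a2 + 1) (hdu1 : |du1| ≤ T * ρ * (a1 + 1 / 2)) (hdw1 : |dw1| ≤ (2 * a1 + 1) / (c ^ 2 * T * a1 ^ 2 * a2 ^ 2)) :
    |du1 * dw1| ≤ (18 / c ^ 2) * (ρ / a1 ^ 2) := by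
  have ha1p : 0 < a1 := by linarith
  have ha2p : 0 < a2 := by linarith
  have hc2 := inv_sq_le_four_div ha1 ha2 h12
  rw [abs_mul]
  refine (mul_le_mul hdu1 hdw1 (abs_nonneg _) (by positivity)).trans ?_
  have h92 : (a1 + 1 / 2) * (2 * a1 + 1) / a1 ^ 2 ≤ 9 / 2 := by
    rw [div_le_iff₀ (by positivity)]
    exact poly_aux2 ha1
  have e : T * ρ * (a1 + 1 / 2) * ((2 * a1 + 1) / (c ^ 2 * T * a1 ^ 2 * a2 ^ 2))
      = (ρ / c ^ 2) * (((a1 + 1 / 2) * (2 * a1 + 1) / a1 ^ 2) * (1 / a2 ^ 2)) := by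
    field_simp
  rw [e]
  have hprod : ((a1 + 1 / 2) * (2 * a1 + 1) / a1 ^ 2) * (1 / a2 ^ 2) ≤ (9 / 2) * (4 / a1 ^ 2) :=
    mul_le_mul h92 hc2 (by positivity) (by norm_num)
  calc (ρ / c ^ 2) * (((a1 + 1 / 2) * (2 * a1 + 1) / a1 ^ 2) * (1 / a2 ^ 2))
      ≤ (ρ / c ^ 2) * ((9 / 2) * (4 / a1 ^ 2)) := mul_le_mul_of_nonneg_left hprod (by positivity)
    _ = _ := by ring

/-- term 4: `|Δu₀|·|Δw₀| ≤ (9/(2c²))·ρ/a₁²`. [folklore] -/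
theorem d2_term4 {du0 dw0 T c a0 a1 ρ : ℝ} (hT : 0 < T) (hc : 0 < c) (ha0 : 1 ≤ a0) (ha1 : 1 ≤ a1) (hρ : 0 ≤ ρ)
    (hdu0 : |du0| ≤ T * ρ * (a0 + 1 / 2)) (hdw0 : |dw0| ≤ (2 * a0 + 1) / (c ^ 2 * T * a0 ^ 2 * a1 ^ 2)) :
    |du0 * dw0| ≤ (9 / (2 * c ^ 2)) * (ρ / a1 ^ 2) := by
  have ha0p : 0 < a0 := by linarith
  have ha1p : 0 < a1 := by linarith
  rw [abs_mul]
  refine (mul_le_mul hdu0 hdw0 (abs_nonneg _) (by positivity)).trans ?_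
  have h92 : (a0 + 1 / 2) * (2 * a0 + 1) / a0 ^ 2 ≤ 9 / 2 := by
    rw [div_le_iff₀ (by positivity)]
    exact poly_aux2 ha0
  have e : T * ρ * (a0 + 1 / 2) * ((2 * a0 + 1) / (c ^ 2 * T * a0 ^ 2 * a1 ^ 2))
      = (ρ / c ^ 2) * (((a0 + 1 / 2) * (2 * a0 + 1) / a0 ^ 2) * (1 / a1 ^ 2)) := by
    field_simp
  rw [e]
  have hprod : ((a0 + 1 / 2) * (2 * a0 + 1) / a0 ^ 2) * (1 / a1 ^ 2) ≤ (9 / 2) * (1 / a1 ^ 2) :=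
    mul_le_mul_of_nonneg_right h92 (by positivity)
  calc (ρ / c ^ 2) * (((a0 + 1 / 2) * (2 * a0 + 1) / a0 ^ 2) * (1 / a1 ^ 2))
      ≤ (ρ / c ^ 2) * ((9 / 2) * (1 / a1 ^ 2)) := mul_le_mul_of_nonneg_left hprod (by positivity)
    _ = _ := by ring

/-- ★ the ABSTRACT SECOND-DIFFERENCE ESTIMATE for `h = u·w`: with `a_i ≥ 1`, `a₁ ≤ a₀ + 1`, `a₁ ≤ a₂ + 1`,
`0 ≤ u₁ ≤ Ta₁²ρ/2`, `|Δu| ≤ Tρ(a + ½)`, `|Δ²u| ≤ Tρ` and the reciprocal bounds of `recip_diff_bounds`,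
`|u₂w₂ − 2u₁w₁ + u₀w₀| ≤ (1/c + 53/(2c²) + 48/c³)·ρ/a₁²`. [folklore] -/
theorem quotient_diff2_bound {u0 u1 u2 w0 w1 w2 T c a0 a1 a2 ρ : ℝ} (hT : 0 < T) (hc : 0 < c)
    (ha0 : 1 ≤ a0) (ha1 : 1 ≤ a1) (ha2 : 1 ≤ a2) (hρ : 0 ≤ ρ)
    (h10 : a1 ≤ a0 + 1) (h12 : a1 ≤ a2 + 1)
    (hu1 : 0 ≤ u1) (hu1' : u1 ≤ T * a1 ^ 2 * ρ / 2)
    (hdu0 : |u1 - u0| ≤ T * ρ * (a0 + 1 / 2)) (hdu1 : |u2 - u1| ≤ T * ρ * (a1 + 1 / 2))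
    (hd2u : |u2 - 2 * u1 + u0| ≤ T * ρ)
    (hw1 : 0 ≤ w1) (hw1' : w1 ≤ 1 / (c * T * a1 ^ 2))
    (hdw0 : |w1 - w0| ≤ (2 * a0 + 1) / (c ^ 2 * T * a0 ^ 2 * a1 ^ 2))
    (hdw1 : |w2 - w1| ≤ (2 * a1 + 1) / (c ^ 2 * T * a1 ^ 2 * a2 ^ 2))
    (hd2w : |w2 - 2 * w1 + w0|
      ≤ 2 / (c ^ 2 * T * a1 ^ 2 * a2 ^ 2) + (2 * a0 + 1) * (2 * a0 + 2 * a1 + 2) / (c ^ 3 * T * a0 ^ 2 * a1 ^ 2 * a2 ^ 2)) :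
    |u2 * w2 - 2 * (u1 * w1) + u0 * w0| ≤ (1 / c + 53 / (2 * c ^ 2) + 48 / c ^ 3) * (ρ / a1 ^ 2) := by
  -- the discrete Leibniz rule
  have key : u2 * w2 - 2 * (u1 * w1) + u0 * w0
      = (u2 - 2 * u1 + u0) * w1 + u1 * (w2 - 2 * w1 + w0) + (u2 - u1) * (w2 - w1) + (u1 - u0) * (w1 - w0) := by ring
  rw [key]
  have t1 := d2_term1 hT hc ha1 hρ hd2u hw1 hw1'
  have t2 := d2_term2 hT hc ha0 ha1 ha2 hρ h10 h12 hu1 hu1' hd2w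
  have t3 := d2_term3 hT hc ha1 ha2 hρ h12 hdu1 hdw1
  have t4 := d2_term4 hT hc ha0 ha1 hρ hdu0 hdw0
  have e1 := abs_add_le ((u2 - 2 * u1 + u0) * w1 + u1 * (w2 - 2 * w1 + w0) + (u2 - u1) * (w2 - w1)) ((u1 - u0) * (w1 - w0))
  have e2 := abs_add_le ((u2 - 2 * u1 + u0) * w1 + u1 * (w2 - 2 * w1 + w0)) ((u2 - u1) * (w2 - w1))
  have e3 := abs_add_le ((u2 - 2 * u1 + u0) * w1) (u1 * (w2 - 2 * w1 + w0))
  have hsum : (1 / c) * (ρ / a1 ^ 2) + (4 / c ^ 2 + 48 / c ^ 3) * (ρ / a1 ^ 2) + (18 / c ^ 2) * (ρ / a1 ^ 2)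
      + (9 / (2 * c ^ 2)) * (ρ / a1 ^ 2) = (1 / c + 53 / (2 * c ^ 2) + 48 / c ^ 3) * (ρ / a1 ^ 2) := by ring
  linarith

end Subsample

end Summit.HubbardSuperconductivity.HubbardSuperconductivity.Theorems.AnisotropyChord.Transfer.Fibre3

end
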